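import Mathlib
import Summits.Parity.BatemanHorn.Theses.PolynomialMobius
import Summits.Parity.BatemanHorn.Theorems.PolynomialMobiusPolyMobiusTailCoreStrength
import Summits.Parity.BatemanHorn.Theorems.PolynomialMobiusPolyMobiusTailStubDegreeOneTail
import Summits.Parity.BatemanHorn.Theorems.PolynomialMobiusPolyMobiusTailStubWindowEqTailEventually
import Summits.Parity.BatemanHorn.Theorems.PolynomialMobiusPolyMobiusTailLargeBandLowDegree

/-!
# Crux `PolyMobiusTail` (stmt-Parity-0870), skeleton `Lines/stub_large.lean`: the EXACT core `CoreSmall`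

REPORT-c6 observed that the registered stub `stub_large_core` (S4a) quantifies over ALL `0 < δ < θ < 1`
while the composition consumes the core only at the window exponent.  This file types the exact core
`CoreSmall(f)` : `∃ θ₀ ∈ (0,1), ∀ 0 < θ ≤ θ₀, ∀ 0 < δ < θ, Core_{θ,δ}(f) = o(x)` (written out, no
auxiliary definition) and proves that — modulo the window in its natural UNIFORM form (`∃ c, ∀ θ, η ∈ (0,c]`;
`k ≤ 1`: `uniformWindow_of_le_one`, linear pairs: `CoreStrength.window_linear_pair_uniform`) and the band
(`stub_large_band_le_two` landed for total degree `≤ 2`, S4b posited for `≥ 3`) — it is EQUIVALENT to the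
crux slice: `tail_slice_of_coreSmall` / `coreSmall_of_tail_slice` (per system), `polyMobiusTail_of_coreSmall`
/ `coreSmall_of_polyMobiusTail` (globally, S2u/S3u/S4b as hypotheses); `coreSmall_of_core_forall` (the
registered S4a gives it); and on linear pairs it IS Hardy–Littlewood with no further hypothesis:
`coreSmall_iff_lambda_pair`, `coreSmall_twin_iff` (`CoreSmall(X, X+2) ⟺ ∑_{n≤x} Λ(n)Λ(n+2) ∼ 2C₂·x`).
Upshot: if the core is promoted, `CoreSmall` for all Bateman–Horn systems is the exactly crux-sized
statement.  Pure bookkeeping over landed theorems; no Bateman–Horn axiom; axioms standard.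
-/

open scoped BigOperators Topology
open Filter Finset Polynomial Asymptotics ArithmeticFunction

namespace Summit.Parity.BatemanHorn.Theorems.PolyMobiusTail.EtaFreeWindow

open Literature.NumberTheory.Sieve

namespace CoreExact

/-! ### Uniform windows -/

/-- **Uniform window for `k ≤ 1` linear members.** For a Bateman–Horn system with `k ≤ 1` members of
degree `≤ 1`, the window `(x^{1-η}, x^{1+θ}]` of the Möbius tail is `o(x)` for ALL `θ, η ∈ (0, 1/2]`
(indeed for all `θ > 0`, `η ∈ (0,1)`): the upper cut is eventually vacuous
(`stub_window_eq_tail_eventually`, p153676) and the tail is `o(x)` at every `η` (`k = 1`: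
`stub_degreeOne_tail`, p153674; `k = 0`: the empty tuple has `∏∅ = 1 ≤ x^{1-η}`). [folklore] -/
theorem uniformWindow_of_le_one {k : ℕ} (f : Fin k → ℤ[X]) (hf : IsBatemanHornSystem f) (hk : k ≤ 1)
    (hdeg : ∀ i, (f i).natDegree ≤ 1) :
    ∃ c : ℝ, 0 < c ∧ c < 1 ∧ ∀ θ η : ℝ, 0 < θ → θ ≤ c → 0 < η → η ≤ c →
      (fun x : ℕ => ∑ n ∈ Finset.Icc 1 x,
        ∑ d ∈ Fintype.piFinset (fun i => (((f i).eval (n : ℤ)).toNat).divisors),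
          if (x : ℝ) ^ (1 - η) < ∏ i, (d i : ℝ) ∧ ∏ i, (d i : ℝ) ≤ (x : ℝ) ^ (1 + θ) then
            ∏ i, ((ArithmeticFunction.moebius (d i) : ℝ) * Real.log (d i)) else 0)
        =o[atTop] fun x : ℕ => (x : ℝ) := by
  refine ⟨1 / 2, by norm_num, by norm_num, fun θ η hθ _ hη hηc => ?_⟩
  have hη1 : η < 1 := by linarith
  have hEq := stub_window_eq_tail_eventually k f hk hdeg θ η hθ
  obtain rfl | rfl : k = 0 ∨ k = 1 := by omega
  · -- `k = 0`: the tail itself vanishes for `x ≥ 1` (`∏∅ = 1 ≤ x^{1-η}`).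
    refine ((isLittleO_zero (fun x : ℕ => (x : ℝ)) atTop).congr' ?_ EventuallyEq.rfl).congr' hEq.symm
      EventuallyEq.rfl
    filter_upwards [eventually_ge_atTop 1] with x hx
    symm
    refine Finset.sum_eq_zero fun n _ => Finset.sum_eq_zero fun d _ => ?_
    rw [if_neg]
    intro h
    rw [Finset.univ_eq_empty, Finset.prod_empty] at h
    exact absurd h (not_lt.mpr (Real.one_le_rpow (by exact_mod_cast hx) (by linarith)))
  · -- `k = 1`: the tail is `o(x)` at every `η ∈ (0,1)`.
    exact (stub_degreeOne_tail f hf (hdeg 0) η hη hη1).congr' hEq.symm EventuallyEq.rfl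

/-- **Uniform window of every Bateman–Horn system, from the pieces**: `k ≤ 1` linear (`uniformWindow_of_le_one`),
the linear pair (`CoreStrength.window_linear_pair_uniform`), `k ≥ 3` linear (hypothesis S2u = the registered
S2 in uniform form), a member of degree `≥ 2` (hypothesis S3u = S3 in uniform form). [folklore] -/
theorem uniformWindow_of_pieces
    (hS2u : ∀ (k : ℕ) (f : Fin k → ℤ[X]), IsBatemanHornSystem f → 3 ≤ k →
      (∀ i, (f i).natDegree ≤ 1) →
      ∃ c : ℝ, 0 < c ∧ c < 1 ∧ ∀ θ η : ℝ, 0 < θ → θ ≤ c → 0 < η → η ≤ c →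
        (fun x : ℕ => ∑ n ∈ Finset.Icc 1 x,
          ∑ d ∈ Fintype.piFinset (fun i => (((f i).eval (n : ℤ)).toNat).divisors),
            if (x : ℝ) ^ (1 - η) < ∏ i, (d i : ℝ) ∧ ∏ i, (d i : ℝ) ≤ (x : ℝ) ^ (1 + θ) then
              ∏ i, ((ArithmeticFunction.moebius (d i) : ℝ) * Real.log (d i)) else 0)
          =o[atTop] fun x : ℕ => (x : ℝ))
    (hS3u : ∀ (k : ℕ) (f : Fin k → ℤ[X]), IsBatemanHornSystem f → (∃ i, 2 ≤ (f i).natDegree) →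
      ∃ c : ℝ, 0 < c ∧ c < 1 ∧ ∀ θ η : ℝ, 0 < θ → θ ≤ c → 0 < η → η ≤ c →
        (fun x : ℕ => ∑ n ∈ Finset.Icc 1 x,
          ∑ d ∈ Fintype.piFinset (fun i => (((f i).eval (n : ℤ)).toNat).divisors),
            if (x : ℝ) ^ (1 - η) < ∏ i, (d i : ℝ) ∧ ∏ i, (d i : ℝ) ≤ (x : ℝ) ^ (1 + θ) then
              ∏ i, ((ArithmeticFunction.moebius (d i) : ℝ) * Real.log (d i)) else 0)
          =o[atTop] fun x : ℕ => (x : ℝ))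
    {k : ℕ} (f : Fin k → ℤ[X]) (hf : IsBatemanHornSystem f) :
    ∃ c : ℝ, 0 < c ∧ c < 1 ∧ ∀ θ η : ℝ, 0 < θ → θ ≤ c → 0 < η → η ≤ c →
      (fun x : ℕ => ∑ n ∈ Finset.Icc 1 x,
        ∑ d ∈ Fintype.piFinset (fun i => (((f i).eval (n : ℤ)).toNat).divisors),
          if (x : ℝ) ^ (1 - η) < ∏ i, (d i : ℝ) ∧ ∏ i, (d i : ℝ) ≤ (x : ℝ) ^ (1 + θ) then
            ∏ i, ((ArithmeticFunction.moebius (d i) : ℝ) * Real.log (d i)) else 0)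
        =o[atTop] fun x : ℕ => (x : ℝ) := by
  by_cases hlin : ∀ i, (f i).natDegree ≤ 1
  · by_cases hk : k ≤ 1
    · exact uniformWindow_of_le_one f hf hk hlin
    · by_cases hk2 : k = 2
      · subst hk2
        exact CoreStrength.window_linear_pair_uniform f hf hlin
      · exact hS2u k f hf (by omega) hlin
  · push Not at hlin
    obtain ⟨i, hi⟩ := hlin
    exact hS3u k f hf ⟨i, by omega⟩

/-- **Band of every Bateman–Horn system, from the pieces**: empty for total degree `≤ 2`
(`stub_large_band_le_two`, landed p154483), hypothesis S4b (= the registered `stub_large_band_three_le`,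
verbatim) for total degree `≥ 3`. [folklore] -/
theorem band_of_pieces
    (hS4b : ∀ (k : ℕ) (f : Fin k → ℤ[X]), IsBatemanHornSystem f →
      3 ≤ ∑ i, (f i).natDegree → ∀ θ δ : ℝ, 0 < θ → θ < 1 → 0 < δ → δ < θ →
      (fun x : ℕ => ∑ n ∈ Finset.Icc 1 x,
        ∑ e ∈ Fintype.piFinset (fun i => (((f i).eval (n : ℤ)).toNat).divisors),
          if (x : ℝ) ^ (1 + θ) < ∏ i, ((((f i).eval (n : ℤ)).toNat / e i : ℕ) : ℝ) ∧
              (x : ℝ) ^ (1 - δ) < ∏ i, (e i : ℝ) then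
            ∏ i, ((ArithmeticFunction.moebius (((f i).eval (n : ℤ)).toNat / e i) : ℝ) *
              Real.log ((((f i).eval (n : ℤ)).toNat / e i : ℕ) : ℝ)) else 0)
        =o[atTop] fun x : ℕ => (x : ℝ))
    {k : ℕ} (f : Fin k → ℤ[X]) (hf : IsBatemanHornSystem f) :
    ∀ θ δ : ℝ, 0 < θ → θ < 1 → 0 < δ → δ < θ →
      (fun x : ℕ => ∑ n ∈ Finset.Icc 1 x,
        ∑ e ∈ Fintype.piFinset (fun i => (((f i).eval (n : ℤ)).toNat).divisors),
          if (x : ℝ) ^ (1 + θ) < ∏ i, ((((f i).eval (n : ℤ)).toNat / e i : ℕ) : ℝ) ∧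
              (x : ℝ) ^ (1 - δ) < ∏ i, (e i : ℝ) then
            ∏ i, ((ArithmeticFunction.moebius (((f i).eval (n : ℤ)).toNat / e i) : ℝ) *
              Real.log ((((f i).eval (n : ℤ)).toNat / e i : ℕ) : ℝ)) else 0)
        =o[atTop] fun x : ℕ => (x : ℝ) := by
  intro θ δ hθ0 hθ1 hδ0 hδθ
  by_cases hG : ∑ i, (f i).natDegree ≤ 2
  · exact stub_large_band_le_two k f hG θ δ hδθ
  · exact hS4b k f hf (by omega) θ δ hθ0 hθ1 hδ0 hδθ

/-! ### Per system: `CoreSmall` ⟺ the crux slice, given the uniform window and the band -/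

/-- **CoreSmall ⟹ the crux slice.**  For any tuple `f` with a uniform window (`∃ c ∈ (0,1)`, window
`o(x)` for all `θ, η ∈ (0,c]`) and the band `o(x)` (all `0 < δ < θ < 1`): if the core is `o(x)` at all
sufficiently small `θ` (`CoreSmall`), then some Möbius tail of `f` is `o(x)` — the `f`-slice of
`PolyMobiusTail`.  Take `θ = η = min(θ₀, c)`, `δ = θ/2`: `Large_θ = Core + Band` (p155041
`large_eq_core_add_band`), then `Tail_η = Win + Large` (p138374 `tail_slice_of_window_of_large`). [folklore] -/
theorem tail_slice_of_coreSmall {k : ℕ} (f : Fin k → ℤ[X])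
    (hW : ∃ c : ℝ, 0 < c ∧ c < 1 ∧ ∀ θ η : ℝ, 0 < θ → θ ≤ c → 0 < η → η ≤ c →
      (fun x : ℕ => ∑ n ∈ Finset.Icc 1 x,
        ∑ d ∈ Fintype.piFinset (fun i => (((f i).eval (n : ℤ)).toNat).divisors),
          if (x : ℝ) ^ (1 - η) < ∏ i, (d i : ℝ) ∧ ∏ i, (d i : ℝ) ≤ (x : ℝ) ^ (1 + θ) then
            ∏ i, ((ArithmeticFunction.moebius (d i) : ℝ) * Real.log (d i)) else 0)
        =o[atTop] fun x : ℕ => (x : ℝ))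
    (hB : ∀ θ δ : ℝ, 0 < θ → θ < 1 → 0 < δ → δ < θ →
      (fun x : ℕ => ∑ n ∈ Finset.Icc 1 x,
        ∑ e ∈ Fintype.piFinset (fun i => (((f i).eval (n : ℤ)).toNat).divisors),
          if (x : ℝ) ^ (1 + θ) < ∏ i, ((((f i).eval (n : ℤ)).toNat / e i : ℕ) : ℝ) ∧
              (x : ℝ) ^ (1 - δ) < ∏ i, (e i : ℝ) then
            ∏ i, ((ArithmeticFunction.moebius (((f i).eval (n : ℤ)).toNat / e i) : ℝ) *
              Real.log ((((f i).eval (n : ℤ)).toNat / e i : ℕ) : ℝ)) else 0)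
        =o[atTop] fun x : ℕ => (x : ℝ))
    (hC : ∃ θ₀ : ℝ, 0 < θ₀ ∧ θ₀ < 1 ∧ ∀ θ δ : ℝ, 0 < θ → θ ≤ θ₀ → 0 < δ → δ < θ →
      (fun x : ℕ => ∑ n ∈ Finset.Icc 1 x,
        ∑ e ∈ Fintype.piFinset (fun i => (((f i).eval (n : ℤ)).toNat).divisors),
          if (x : ℝ) ^ (1 + θ) < ∏ i, ((((f i).eval (n : ℤ)).toNat / e i : ℕ) : ℝ) ∧
              ∏ i, (e i : ℝ) ≤ (x : ℝ) ^ (1 - δ) then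
            ∏ i, ((ArithmeticFunction.moebius (((f i).eval (n : ℤ)).toNat / e i) : ℝ) *
              Real.log ((((f i).eval (n : ℤ)).toNat / e i : ℕ) : ℝ)) else 0)
        =o[atTop] fun x : ℕ => (x : ℝ)) :
    ∃ η : ℝ, 0 < η ∧ η < 1 ∧
      (fun x : ℕ => ∑ n ∈ Finset.Icc 1 x,
        ∑ d ∈ Fintype.piFinset (fun i => (((f i).eval (n : ℤ)).toNat).divisors),
          if (x : ℝ) ^ (1 - η) < ∏ i, (d i : ℝ) then
            ∏ i, ((ArithmeticFunction.moebius (d i) : ℝ) * Real.log (d i)) else 0)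
        =o[atTop] fun x : ℕ => (x : ℝ) := by
  obtain ⟨c, hc0, hc1, hW⟩ := hW
  obtain ⟨θ₀, h₀0, h₀1, hC⟩ := hC
  set θ : ℝ := min θ₀ c with hθ_def
  have hθ0 : 0 < θ := lt_min h₀0 hc0
  have hθc : θ ≤ c := min_le_right _ _
  have hθθ₀ : θ ≤ θ₀ := min_le_left _ _
  have hθ1 : θ < 1 := lt_of_le_of_lt hθc hc1
  have hWin := hW θ θ hθ0 hθc hθ0 hθc
  have hCore := hC θ (θ / 2) hθ0 hθθ₀ (by linarith) (by linarith)
  have hBand := hB θ (θ / 2) hθ0 hθ1 (by linarith) (by linarith)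
  have hLarge : (fun x : ℕ => ∑ n ∈ Finset.Icc 1 x,
      ∑ e ∈ Fintype.piFinset (fun i => (((f i).eval (n : ℤ)).toNat).divisors),
        if (x : ℝ) ^ (1 + θ) < ∏ i, ((((f i).eval (n : ℤ)).toNat / e i : ℕ) : ℝ) then
          ∏ i, ((ArithmeticFunction.moebius (((f i).eval (n : ℤ)).toNat / e i) : ℝ) *
            Real.log ((((f i).eval (n : ℤ)).toNat / e i : ℕ) : ℝ)) else 0)
      =o[atTop] fun x : ℕ => (x : ℝ) :=
    (hCore.add hBand).congr_left fun x => (large_eq_core_add_band f θ (θ / 2) x).symm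
  exact tail_slice_of_window_of_large f hθ0 hθ1 hθ0.le hWin hLarge

/-- **The crux slice ⟹ CoreSmall.**  For a Bateman–Horn system `f` with a uniform window and the band
`o(x)`: if SOME Möbius tail of `f` is `o(x)` (the `f`-slice of `PolyMobiusTail`), then the core is `o(x)`
at every `0 < θ ≤ c`, `0 < δ < θ` (`θ₀ = c`, the window constant).  Route: tail `o(x)` at one `η` ⟹
`∑ ∏ Λ(fᵢ(n)) ∼ C(f)x` (`CoreStrength.lambda_isEquivalent_of_tail`, unconditional) ⟹ tail `o(x)` at
`η = θ` (`CoreStrength.tail_of_lambda_isEquivalent`) ⟹ `Large_θ = o(x)` (p138374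
`stub_large_iff_tail_of_window`, window at `(θ, θ)`) ⟹ `Core = Large − Band`. [folklore] -/
theorem coreSmall_of_tail_slice {k : ℕ} (f : Fin k → ℤ[X]) (hf : IsBatemanHornSystem f)
    (hW : ∃ c : ℝ, 0 < c ∧ c < 1 ∧ ∀ θ η : ℝ, 0 < θ → θ ≤ c → 0 < η → η ≤ c →
      (fun x : ℕ => ∑ n ∈ Finset.Icc 1 x,
        ∑ d ∈ Fintype.piFinset (fun i => (((f i).eval (n : ℤ)).toNat).divisors),
          if (x : ℝ) ^ (1 - η) < ∏ i, (d i : ℝ) ∧ ∏ i, (d i : ℝ) ≤ (x : ℝ) ^ (1 + θ) then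
            ∏ i, ((ArithmeticFunction.moebius (d i) : ℝ) * Real.log (d i)) else 0)
        =o[atTop] fun x : ℕ => (x : ℝ))
    (hB : ∀ θ δ : ℝ, 0 < θ → θ < 1 → 0 < δ → δ < θ →
      (fun x : ℕ => ∑ n ∈ Finset.Icc 1 x,
        ∑ e ∈ Fintype.piFinset (fun i => (((f i).eval (n : ℤ)).toNat).divisors),
          if (x : ℝ) ^ (1 + θ) < ∏ i, ((((f i).eval (n : ℤ)).toNat / e i : ℕ) : ℝ) ∧
              (x : ℝ) ^ (1 - δ) < ∏ i, (e i : ℝ) then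
            ∏ i, ((ArithmeticFunction.moebius (((f i).eval (n : ℤ)).toNat / e i) : ℝ) *
              Real.log ((((f i).eval (n : ℤ)).toNat / e i : ℕ) : ℝ)) else 0)
        =o[atTop] fun x : ℕ => (x : ℝ))
    (hT : ∃ η : ℝ, 0 < η ∧ η < 1 ∧
      (fun x : ℕ => ∑ n ∈ Finset.Icc 1 x,
        ∑ d ∈ Fintype.piFinset (fun i => (((f i).eval (n : ℤ)).toNat).divisors),
          if (x : ℝ) ^ (1 - η) < ∏ i, (d i : ℝ) then
            ∏ i, ((ArithmeticFunction.moebius (d i) : ℝ) * Real.log (d i)) else 0)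
        =o[atTop] fun x : ℕ => (x : ℝ)) :
    ∃ θ₀ : ℝ, 0 < θ₀ ∧ θ₀ < 1 ∧ ∀ θ δ : ℝ, 0 < θ → θ ≤ θ₀ → 0 < δ → δ < θ →
      (fun x : ℕ => ∑ n ∈ Finset.Icc 1 x,
        ∑ e ∈ Fintype.piFinset (fun i => (((f i).eval (n : ℤ)).toNat).divisors),
          if (x : ℝ) ^ (1 + θ) < ∏ i, ((((f i).eval (n : ℤ)).toNat / e i : ℕ) : ℝ) ∧
              ∏ i, (e i : ℝ) ≤ (x : ℝ) ^ (1 - δ) then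
            ∏ i, ((ArithmeticFunction.moebius (((f i).eval (n : ℤ)).toNat / e i) : ℝ) *
              Real.log ((((f i).eval (n : ℤ)).toNat / e i : ℕ) : ℝ)) else 0)
        =o[atTop] fun x : ℕ => (x : ℝ) := by
  obtain ⟨c, hc0, hc1, hW⟩ := hW
  obtain ⟨η, hη0, hη1, hT⟩ := hT
  -- the Λ-asymptotic of `f`, once and for all
  obtain ⟨C, -, hHas, hL⟩ := CoreStrength.lambda_isEquivalent_of_tail hf hη0 hη1 hT
  refine ⟨c, hc0, hc1, fun θ δ hθ0 hθc hδ0 hδθ => ?_⟩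
  have hθ1 : θ < 1 := lt_of_le_of_lt hθc hc1
  -- tail at `η = θ`, window at `(θ, θ)`, hence the large part at `θ`
  have hTθ := CoreStrength.tail_of_lambda_isEquivalent hf hHas hL hθ0 hθ1
  have hWin := hW θ θ hθ0 hθc hθ0 hθc
  have hLarge := (stub_large_iff_tail_of_window k f θ θ hθ0 hθ0.le hWin).mpr hTθ
  have hBand := hB θ δ hθ0 hθ1 hδ0 hδθ
  refine (hLarge.sub hBand).congr_left fun x => ?_
  rw [large_eq_core_add_band f θ δ x, add_sub_cancel_right]

/-- **The registered S4a gives CoreSmall** (`θ₀ = 1/2`): `stub_large_core`'s conclusion for `f` ⟹ CoreSmall(f). [folklore] -/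
theorem coreSmall_of_core_forall {k : ℕ} (f : Fin k → ℤ[X])
    (hCore : ∀ θ δ : ℝ, 0 < θ → θ < 1 → 0 < δ → δ < θ →
      (fun x : ℕ => ∑ n ∈ Finset.Icc 1 x,
        ∑ e ∈ Fintype.piFinset (fun i => (((f i).eval (n : ℤ)).toNat).divisors),
          if (x : ℝ) ^ (1 + θ) < ∏ i, ((((f i).eval (n : ℤ)).toNat / e i : ℕ) : ℝ) ∧
              ∏ i, (e i : ℝ) ≤ (x : ℝ) ^ (1 - δ) then
            ∏ i, ((ArithmeticFunction.moebius (((f i).eval (n : ℤ)).toNat / e i) : ℝ) *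
              Real.log ((((f i).eval (n : ℤ)).toNat / e i : ℕ) : ℝ)) else 0)
        =o[atTop] fun x : ℕ => (x : ℝ)) :
    ∃ θ₀ : ℝ, 0 < θ₀ ∧ θ₀ < 1 ∧ ∀ θ δ : ℝ, 0 < θ → θ ≤ θ₀ → 0 < δ → δ < θ →
      (fun x : ℕ => ∑ n ∈ Finset.Icc 1 x,
        ∑ e ∈ Fintype.piFinset (fun i => (((f i).eval (n : ℤ)).toNat).divisors),
          if (x : ℝ) ^ (1 + θ) < ∏ i, ((((f i).eval (n : ℤ)).toNat / e i : ℕ) : ℝ) ∧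
              ∏ i, (e i : ℝ) ≤ (x : ℝ) ^ (1 - δ) then
            ∏ i, ((ArithmeticFunction.moebius (((f i).eval (n : ℤ)).toNat / e i) : ℝ) *
              Real.log ((((f i).eval (n : ℤ)).toNat / e i : ℕ) : ℝ)) else 0)
        =o[atTop] fun x : ℕ => (x : ℝ) :=
  ⟨1 / 2, by norm_num, by norm_num, fun θ δ hθ0 hθc hδ0 hδθ =>
    hCore θ δ hθ0 (by linarith) hδ0 hδθ⟩

/-! ### Globally: `CoreSmall` for all systems ⟺ the crux, modulo uniform windows and the band -/

/-- **`(∀ f, CoreSmall f)` ⟹ `PolyMobiusTail`**, given the uniform window stubs S2u (`k ≥ 3` linear), S3u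
(a member of degree `≥ 2`) and the band stub S4b (total degree `≥ 3`) as hypotheses; the `k ≤ 1` and
linear-pair windows and the low-degree band are theorems.  (The skeleton's `PolyMobiusTail_of` with the
exact core in place of S4a.) [folklore] -/
theorem polyMobiusTail_of_coreSmall
    (hCoreSmall : ∀ (k : ℕ) (f : Fin k → ℤ[X]), IsBatemanHornSystem f →
      ∃ θ₀ : ℝ, 0 < θ₀ ∧ θ₀ < 1 ∧ ∀ θ δ : ℝ, 0 < θ → θ ≤ θ₀ → 0 < δ → δ < θ →
      (fun x : ℕ => ∑ n ∈ Finset.Icc 1 x,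
        ∑ e ∈ Fintype.piFinset (fun i => (((f i).eval (n : ℤ)).toNat).divisors),
          if (x : ℝ) ^ (1 + θ) < ∏ i, ((((f i).eval (n : ℤ)).toNat / e i : ℕ) : ℝ) ∧
              ∏ i, (e i : ℝ) ≤ (x : ℝ) ^ (1 - δ) then
            ∏ i, ((ArithmeticFunction.moebius (((f i).eval (n : ℤ)).toNat / e i) : ℝ) *
              Real.log ((((f i).eval (n : ℤ)).toNat / e i : ℕ) : ℝ)) else 0)
        =o[atTop] fun x : ℕ => (x : ℝ))
    (hS4b : ∀ (k : ℕ) (f : Fin k → ℤ[X]), IsBatemanHornSystem f →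
      3 ≤ ∑ i, (f i).natDegree → ∀ θ δ : ℝ, 0 < θ → θ < 1 → 0 < δ → δ < θ →
      (fun x : ℕ => ∑ n ∈ Finset.Icc 1 x,
        ∑ e ∈ Fintype.piFinset (fun i => (((f i).eval (n : ℤ)).toNat).divisors),
          if (x : ℝ) ^ (1 + θ) < ∏ i, ((((f i).eval (n : ℤ)).toNat / e i : ℕ) : ℝ) ∧
              (x : ℝ) ^ (1 - δ) < ∏ i, (e i : ℝ) then
            ∏ i, ((ArithmeticFunction.moebius (((f i).eval (n : ℤ)).toNat / e i) : ℝ) *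
              Real.log ((((f i).eval (n : ℤ)).toNat / e i : ℕ) : ℝ)) else 0)
        =o[atTop] fun x : ℕ => (x : ℝ))
    (hS2u : ∀ (k : ℕ) (f : Fin k → ℤ[X]), IsBatemanHornSystem f → 3 ≤ k →
      (∀ i, (f i).natDegree ≤ 1) →
      ∃ c : ℝ, 0 < c ∧ c < 1 ∧ ∀ θ η : ℝ, 0 < θ → θ ≤ c → 0 < η → η ≤ c →
        (fun x : ℕ => ∑ n ∈ Finset.Icc 1 x,
          ∑ d ∈ Fintype.piFinset (fun i => (((f i).eval (n : ℤ)).toNat).divisors),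
            if (x : ℝ) ^ (1 - η) < ∏ i, (d i : ℝ) ∧ ∏ i, (d i : ℝ) ≤ (x : ℝ) ^ (1 + θ) then
              ∏ i, ((ArithmeticFunction.moebius (d i) : ℝ) * Real.log (d i)) else 0)
          =o[atTop] fun x : ℕ => (x : ℝ))
    (hS3u : ∀ (k : ℕ) (f : Fin k → ℤ[X]), IsBatemanHornSystem f → (∃ i, 2 ≤ (f i).natDegree) →
      ∃ c : ℝ, 0 < c ∧ c < 1 ∧ ∀ θ η : ℝ, 0 < θ → θ ≤ c → 0 < η → η ≤ c →
        (fun x : ℕ => ∑ n ∈ Finset.Icc 1 x,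
          ∑ d ∈ Fintype.piFinset (fun i => (((f i).eval (n : ℤ)).toNat).divisors),
            if (x : ℝ) ^ (1 - η) < ∏ i, (d i : ℝ) ∧ ∏ i, (d i : ℝ) ≤ (x : ℝ) ^ (1 + θ) then
              ∏ i, ((ArithmeticFunction.moebius (d i) : ℝ) * Real.log (d i)) else 0)
          =o[atTop] fun x : ℕ => (x : ℝ)) :
    Summit.Parity.BatemanHorn.Theses.PolynomialMobius.PolyMobiusTail := by
  intro k f hf
  exact tail_slice_of_coreSmall f (uniformWindow_of_pieces hS2u hS3u f hf) (band_of_pieces hS4b f hf)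
    (hCoreSmall k f hf)

/-- **`PolyMobiusTail` ⟹ `(∀ f, CoreSmall f)`**, given the same window and band hypotheses: the exact
core is NOT stronger than the crux (modulo S2u, S3u, S4b).  Together with `polyMobiusTail_of_coreSmall`:
modulo the windows and the band, `CoreSmall` for all Bateman–Horn systems IS the crux. [folklore] -/
theorem coreSmall_of_polyMobiusTail
    (hTail : Summit.Parity.BatemanHorn.Theses.PolynomialMobius.PolyMobiusTail)
    (hS4b : ∀ (k : ℕ) (f : Fin k → ℤ[X]), IsBatemanHornSystem f →
      3 ≤ ∑ i, (f i).natDegree → ∀ θ δ : ℝ, 0 < θ → θ < 1 → 0 < δ → δ < θ →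
      (fun x : ℕ => ∑ n ∈ Finset.Icc 1 x,
        ∑ e ∈ Fintype.piFinset (fun i => (((f i).eval (n : ℤ)).toNat).divisors),
          if (x : ℝ) ^ (1 + θ) < ∏ i, ((((f i).eval (n : ℤ)).toNat / e i : ℕ) : ℝ) ∧
              (x : ℝ) ^ (1 - δ) < ∏ i, (e i : ℝ) then
            ∏ i, ((ArithmeticFunction.moebius (((f i).eval (n : ℤ)).toNat / e i) : ℝ) *
              Real.log ((((f i).eval (n : ℤ)).toNat / e i : ℕ) : ℝ)) else 0)
        =o[atTop] fun x : ℕ => (x : ℝ))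
    (hS2u : ∀ (k : ℕ) (f : Fin k → ℤ[X]), IsBatemanHornSystem f → 3 ≤ k →
      (∀ i, (f i).natDegree ≤ 1) →
      ∃ c : ℝ, 0 < c ∧ c < 1 ∧ ∀ θ η : ℝ, 0 < θ → θ ≤ c → 0 < η → η ≤ c →
        (fun x : ℕ => ∑ n ∈ Finset.Icc 1 x,
          ∑ d ∈ Fintype.piFinset (fun i => (((f i).eval (n : ℤ)).toNat).divisors),
            if (x : ℝ) ^ (1 - η) < ∏ i, (d i : ℝ) ∧ ∏ i, (d i : ℝ) ≤ (x : ℝ) ^ (1 + θ) then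
              ∏ i, ((ArithmeticFunction.moebius (d i) : ℝ) * Real.log (d i)) else 0)
          =o[atTop] fun x : ℕ => (x : ℝ))
    (hS3u : ∀ (k : ℕ) (f : Fin k → ℤ[X]), IsBatemanHornSystem f → (∃ i, 2 ≤ (f i).natDegree) →
      ∃ c : ℝ, 0 < c ∧ c < 1 ∧ ∀ θ η : ℝ, 0 < θ → θ ≤ c → 0 < η → η ≤ c →
        (fun x : ℕ => ∑ n ∈ Finset.Icc 1 x,
          ∑ d ∈ Fintype.piFinset (fun i => (((f i).eval (n : ℤ)).toNat).divisors),
            if (x : ℝ) ^ (1 - η) < ∏ i, (d i : ℝ) ∧ ∏ i, (d i : ℝ) ≤ (x : ℝ) ^ (1 + θ) then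
              ∏ i, ((ArithmeticFunction.moebius (d i) : ℝ) * Real.log (d i)) else 0)
          =o[atTop] fun x : ℕ => (x : ℝ)) :
    ∀ (k : ℕ) (f : Fin k → ℤ[X]), IsBatemanHornSystem f →
      ∃ θ₀ : ℝ, 0 < θ₀ ∧ θ₀ < 1 ∧ ∀ θ δ : ℝ, 0 < θ → θ ≤ θ₀ → 0 < δ → δ < θ →
      (fun x : ℕ => ∑ n ∈ Finset.Icc 1 x,
        ∑ e ∈ Fintype.piFinset (fun i => (((f i).eval (n : ℤ)).toNat).divisors),
          if (x : ℝ) ^ (1 + θ) < ∏ i, ((((f i).eval (n : ℤ)).toNat / e i : ℕ) : ℝ) ∧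
              ∏ i, (e i : ℝ) ≤ (x : ℝ) ^ (1 - δ) then
            ∏ i, ((ArithmeticFunction.moebius (((f i).eval (n : ℤ)).toNat / e i) : ℝ) *
              Real.log ((((f i).eval (n : ℤ)).toNat / e i : ℕ) : ℝ)) else 0)
        =o[atTop] fun x : ℕ => (x : ℝ) := by
  intro k f hf
  exact coreSmall_of_tail_slice f hf (uniformWindow_of_pieces hS2u hS3u f hf) (band_of_pieces hS4b f hf)
    (hTail k f hf)

/-! ### Linear pairs: `CoreSmall` IS Hardy–Littlewood -/

/-- **On a Bateman–Horn linear pair, CoreSmall(f) ⟺ the `Λ`-Hardy–Littlewood asymptotic for `f`** — no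
window or band hypothesis (both are theorems for pairs: `CoreStrength.window_linear_pair_uniform`,
`stub_large_band_le_two`).  `→`: at `θ = min(θ₀, c(f))`, `δ = θ/2`, by `CoreStrength.core_iff_lambda_pair`;
`←`: `θ₀ = c(f)` by the same. [folklore] -/
theorem coreSmall_iff_lambda_pair : ∀ (f : Fin 2 → ℤ[X]), IsBatemanHornSystem f →
    (∀ i, (f i).natDegree ≤ 1) →
    ((∃ θ₀ : ℝ, 0 < θ₀ ∧ θ₀ < 1 ∧ ∀ θ δ : ℝ, 0 < θ → θ ≤ θ₀ → 0 < δ → δ < θ →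
      (fun x : ℕ => ∑ n ∈ Finset.Icc 1 x,
        ∑ e ∈ Fintype.piFinset (fun i => (((f i).eval (n : ℤ)).toNat).divisors),
          if (x : ℝ) ^ (1 + θ) < ∏ i, ((((f i).eval (n : ℤ)).toNat / e i : ℕ) : ℝ) ∧
              ∏ i, (e i : ℝ) ≤ (x : ℝ) ^ (1 - δ) then
            ∏ i, ((ArithmeticFunction.moebius (((f i).eval (n : ℤ)).toNat / e i) : ℝ) *
              Real.log ((((f i).eval (n : ℤ)).toNat / e i : ℕ) : ℝ)) else 0)
        =o[atTop] fun x : ℕ => (x : ℝ)) ↔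
    ∃ C : ℝ, 0 < C ∧ HasBatemanHornConst f C ∧
      (fun x : ℕ => ∑ n ∈ Finset.Icc 1 x, ∏ i, vonMangoldt (((f i).eval (n : ℤ)).toNat))
        ~[atTop] (fun x : ℕ => C * (x : ℝ))) := by
  intro f hf hlin
  obtain ⟨c, hc0, hc1, hiff⟩ := CoreStrength.core_iff_lambda_pair f hf hlin
  constructor
  · rintro ⟨θ₀, h₀0, -, hC⟩
    have hθ0 : 0 < min θ₀ c := lt_min h₀0 hc0
    exact (hiff (min θ₀ c) (min θ₀ c / 2) hθ0 (min_le_right _ _) (by linarith)).mp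
      (hC (min θ₀ c) (min θ₀ c / 2) hθ0 (min_le_left _ _) (by linarith) (by linarith))
  · intro hΛ
    exact ⟨c, hc0, hc1, fun θ δ hθ0 hθc _ hδθ => (hiff θ δ hθ0 hθc hδθ).mpr hΛ⟩

/-- **CoreSmall for the twin system `(X, X + 2)` ⟺ the Hardy–Littlewood twin asymptotic in `Λ`-form**
`∑_{n≤x} Λ(n)Λ(n+2) ∼ 2C₂·x` (`C₂ = twinPrimeConst`; the Bateman–Horn constant of `(X, X+2)` is `2C₂`,
`hasBatemanHornConst_twinSystem tendsto_twinPrimeConstPartial_holds`). [folklore] -/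
theorem coreSmall_twin_iff :
    (∃ θ₀ : ℝ, 0 < θ₀ ∧ θ₀ < 1 ∧ ∀ θ δ : ℝ, 0 < θ → θ ≤ θ₀ → 0 < δ → δ < θ →
      (fun x : ℕ => ∑ n ∈ Finset.Icc 1 x,
        ∑ e ∈ Fintype.piFinset (fun i => (((twinSystem i).eval (n : ℤ)).toNat).divisors),
          if (x : ℝ) ^ (1 + θ) < ∏ i, ((((twinSystem i).eval (n : ℤ)).toNat / e i : ℕ) : ℝ) ∧
              ∏ i, (e i : ℝ) ≤ (x : ℝ) ^ (1 - δ) then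
            ∏ i, ((ArithmeticFunction.moebius (((twinSystem i).eval (n : ℤ)).toNat / e i) : ℝ) *
              Real.log ((((twinSystem i).eval (n : ℤ)).toNat / e i : ℕ) : ℝ)) else 0)
        =o[atTop] fun x : ℕ => (x : ℝ)) ↔
    (fun x : ℕ => ∑ n ∈ Finset.Icc 1 x, ∏ i, vonMangoldt (((twinSystem i).eval (n : ℤ)).toNat))
      ~[atTop] (fun x : ℕ => 2 * twinPrimeConst * (x : ℝ)) := by
  have hHas2 : HasBatemanHornConst twinSystem (2 * twinPrimeConst) :=
    hasBatemanHornConst_twinSystem tendsto_twinPrimeConstPartial_holds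
  rw [coreSmall_iff_lambda_pair twinSystem isBatemanHornSystem_twinSystem
    CoreStrength.natDegree_twinSystem_le_one]
  constructor
  · rintro ⟨C, -, hHas, hL⟩
    have hCeq : C = 2 * twinPrimeConst := tendsto_nhds_unique hHas hHas2
    rwa [hCeq] at hL
  · intro hL
    exact ⟨2 * twinPrimeConst, mul_pos two_pos twinPrimeConst_pos_holds, hHas2, hL⟩

end CoreExact

end Summit.Parity.BatemanHorn.Theorems.PolyMobiusTail.EtaFreeWindow
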